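import Mathlib
import HarnessLib
import Literature.MathematicalPhysics.QuantumFieldTheory.ConstructiveQFTWave0
import Summits.QuantumFields.GaugeBoot.LatticeWords
import Summits.Ventures.LatticeQCDFlow.Scaling.GaugeForestTrivial

/-!
# LatticeQCDFlow / Scaling — gauge classes on a cycle: word holonomies are gauge covariant, and on
# a simple cycle two configurations are gauge related iff their holonomies are conjugate (ear lemma)

HONEST FRAMING: exact (Metropolis-corrected) sampling algorithms for lattice gauge theory;
figures of merit are autocorrelation/cost numbers at stated couplings and volumes; no
continuum-physics claim.

Venture `LatticeQCDFlow` (cell pub-lqcd), topic `Scaling`, FANOUT row 30 (lean-1, GEN-16) — OUR WORK,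
the combinatorial heart of the CYCLE step of the gauge-redundancy files
(`Scaling/AutoregressiveGaugeRedundancy*`, THEORY-2.md §4 row C5, the gauge case in link
variables).  GEN-15 proved: partial Haar marginals of gauge-invariant weights read the retained
links only modulo gauge tested off the integrated set (`coordAvg_eq_of_gaugeRelated_off`), forests
are gauge trivial (`Scaling/GaugeForestTrivial`), the marginal of one PLAQUETTE is a class function
of its holonomy (`Scaling/AutoregressiveGaugePlaquetteClass`, by a link-by-link normal form).  This
file does the general CYCLE at the level of configurations — every group `G`, every `d`, `L`, no
topology, no measure — over the word layer of the tree's `Summits/QuantumFields/GaugeBoot/LatticeWords`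
(`Step`, `Word`, `Step.apply`, `Step.edge`, `Word.endpoint`, `stepHolonomy`, `wordHolonomy`): the
visited sites of a word `w` read from `x` are the list `w.scanl Step.apply x`, its traversed links
`List.zipWith Step.edge (w.scanl Step.apply x) w` (§0 bookkeeping; `wordHolonomy_congr_of_forall_mem`).

* §1 **`wordHolonomy_gaugeTransform`**: `hol_w(U^γ)(x) = γ(x) · hol_w(U)(x) · γ(end)⁻¹`; closed words
  transform by conjugation, class functions of closed-word holonomies are gauge-invariant
  observables, and NECESSITY `wordHolonomy_eq_conj_of_eqOn`: gauge related on the links of a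
  closed word ⇒ conjugate holonomies.
* §2 TRANSPORT along a simple open path (visited sites pairwise distinct), keeping a given `γ₀` off
  the path and at its end: `exists_gaugeTransform_eq_on_path_keep` (`…_on_path`: end value
  prescribed).
* §3 **THE EAR LEMMA `exists_gaugeTransform_ear`**: for an ear `s :: p` from `y` (sites after `y`
  pairwise distinct; `y` off them, or equal to the end) and any `γ₀`, the covariance identity
  `hol(U') = γ₀(y) · hol(U) · γ₀(end)⁻¹` SUFFICES for a `γ` agreeing with `γ₀` off the interior of the
  ear and at both ends to map `U` to `U'` on the whole ear (transport along `p`; the first link is then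
  forced) — the inductive step of the gauge classification along an ear decomposition.  Corollary
  **`exists_gaugeTransform_eq_on_cycle`**: on a closed simple word, `hol(U') = k · hol(U) · k⁻¹` ⇒
  gauge related by a `γ` with `γ(x) = k`.
* §4 **`gaugeRelated_on_cycle_iff`**: two configurations are gauge related on the links of a simple
  cycle iff their holonomies are conjugate (`IsConj`).
* §5 THE PLAQUETTE (`i ≠ j`, `L ≥ 2`): `plaquette_zipWith_edge`, `plaquette_tail_scanl_nodup`,
  **`gaugeRelated_on_plaquette_iff`** (gauge related on the four links iff the plaquette holonomies
  `U₁ U₂ U₃⁻¹ U₄⁻¹` are conjugate), `exists_gaugeTransform_eq_on_plaquette`.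

Sequels: forests hanging off a cycle and TWO cycles through a point (the invariant is the JOINT
conjugacy class of the pair of holonomies) — `Scaling/GaugeCycleForests`; the measure level (the
exact conditional of a cycle-closing link is a class function of the cycle holonomy) over
`Scaling/AutoregressiveGaugeRedundancy`.  NOT CLAIMED: anything at the measure level here;
uniqueness of `γ`; any number of ours.  Nearest prints: gauge orbits of connections on a finite
graph are `G^E / G^V`, classified by based holonomies modulo simultaneous conjugation — folklore of
lattice gauge theory and loop quantisation (R. Giles, Phys. Rev. D 24 (1981) 2160; J. Baez, Adv.
Math. 117 (1996) 253 §2; R. Gambini, J. Pullin, *Loops, Knots, Gauge Theories and Quantum Gravity*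
(1996) Ch. 1; maximal trees: M. Creutz, *Quarks, gluons and lattices* (1983) Ch. 9); presearch
(corpus hybrid + vector, galaxy; 2026-08-24): the holonomy-groupoid form only, no link-by-link ear
form, nothing typed.  No definition is introduced; nothing is cited as a fact; no `sorry`.
-/

noncomputable section

namespace Summit.Ventures.LatticeQCDFlow.Theory2.Autoregressive

open Function
open Literature.MathematicalPhysics.QuantumFieldTheory
open Summit.QuantumFields.GaugeBoot

variable {d L : ℕ} {G : Type*} [Group G]

/-! ## §0 Word bookkeeping: visited sites `w.scanl Step.apply x`, traversed links
`List.zipWith Step.edge (w.scanl Step.apply x) w` -/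

/-- The visited sites of `s :: w` from `x` are `x` followed by the visited sites of `w` from
`s.apply x`. [ours] -/
theorem scanl_apply_cons (x : Site d L) (s : Step d) (w : Word d) :
    (s :: w).scanl Step.apply x = x :: w.scanl Step.apply (s.apply x) := by
  simp [List.scanl_cons]

/-- The traversed links of `s :: w` from `x` are `s.edge x` followed by the traversed links of `w`
from `s.apply x`. [ours] -/
theorem zipWith_edge_cons (x : Site d L) (s : Step d) (w : Word d) :
    List.zipWith Step.edge ((s :: w).scanl Step.apply x) (s :: w) =
      s.edge x :: List.zipWith Step.edge (w.scanl Step.apply (s.apply x)) w := by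
  simp [List.scanl_cons]

/-- The endpoint of a word is one of its visited sites (the last). [ours] -/
theorem endpoint_mem_scanl : ∀ (x : Site d L) (w : Word d), Word.endpoint x w ∈ w.scanl Step.apply x
  | x, [] => by simp
  | x, s :: w => by
    rw [scanl_apply_cons, Word.endpoint_cons]
    exact List.mem_cons_of_mem _ (endpoint_mem_scanl (s.apply x) w)

/-- The start of a word is one of its visited sites (the first). [ours] -/
theorem start_mem_scanl (x : Site d L) (w : Word d) : x ∈ w.scanl Step.apply x := by
  cases w <;> simp [List.scanl_cons]

/-- The link traversed by the step `s` from `x` joins `x` and `s.apply x`: it starts at `x` and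
ends at `s.apply x` (forward step) or starts at `s.apply x` and ends at `x` (backward step). [ours] -/
theorem edge_endpoints (x : Site d L) (s : Step d) :
    ((s.edge x).1 = x ∧ (s.edge x).1.shift (s.edge x).2 = s.apply x) ∨
      ((s.edge x).1 = s.apply x ∧ (s.edge x).1.shift (s.edge x).2 = x) := by
  cases s with
  | fwd μ => exact Or.inl ⟨rfl, rfl⟩
  | bwd μ => exact Or.inr ⟨rfl, by simp [Step.edge, Site.shift]⟩

/-- Both endpoints of every traversed link are visited sites. [ours] -/
theorem endpoints_mem_scanl_of_mem_zipWith :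
    ∀ (x : Site d L) (w : Word d) {e : Edge d L},
      e ∈ List.zipWith Step.edge (w.scanl Step.apply x) w →
        e.1 ∈ w.scanl Step.apply x ∧ e.1.shift e.2 ∈ w.scanl Step.apply x
  | x, [], e, he => by simp at he
  | x, s :: w, e, he => by
    rw [zipWith_edge_cons] at he
    rw [scanl_apply_cons]
    rcases List.mem_cons.1 he with rfl | he'
    · rcases edge_endpoints x s with ⟨h1, h2⟩ | ⟨h1, h2⟩
      · rw [h2, h1]
        exact ⟨List.mem_cons_self, List.mem_cons_of_mem _ (start_mem_scanl _ _)⟩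
      · rw [h2, h1]
        exact ⟨List.mem_cons_of_mem _ (start_mem_scanl _ _), List.mem_cons_self⟩
    · obtain ⟨h1, h2⟩ := endpoints_mem_scanl_of_mem_zipWith (s.apply x) w he'
      exact ⟨List.mem_cons_of_mem _ h1, List.mem_cons_of_mem _ h2⟩

/-- A word holonomy reads only the traversed links (membership form of the tree's
`wordHolonomy_congr`). [ours] -/
theorem wordHolonomy_congr_of_forall_mem {U V : GaugeConfig d L G} :
    ∀ (x : Site d L) (w : Word d),
      (∀ e ∈ List.zipWith Step.edge (w.scanl Step.apply x) w, U e = V e) →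
        wordHolonomy U x w = wordHolonomy V x w
  | x, [], _ => by simp
  | x, s :: w, h => by
    rw [zipWith_edge_cons] at h
    rw [wordHolonomy_cons, wordHolonomy_cons, stepHolonomy_eq, stepHolonomy_eq,
      h _ List.mem_cons_self,
      wordHolonomy_congr_of_forall_mem (s.apply x) w fun e he => h e (List.mem_cons_of_mem _ he)]

/-- A gauge transformation reads, on a link, only its values at the two endpoints. [ours] -/
theorem gaugeTransform_congr_endpoints {γ γ' : Site d L → G} (U : GaugeConfig d L G) {e : Edge d L}
    (h1 : γ e.1 = γ' e.1) (h2 : γ (e.1.shift e.2) = γ' (e.1.shift e.2)) :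
    gaugeTransform γ U e = gaugeTransform γ' U e := by
  simp [gaugeTransform, h1, h2]

/-! ## §1 Word holonomies are gauge covariant -/

/-- One step: `hol_s(U^γ)(x) = γ(x) · hol_s(U)(x) · γ(s.apply x)⁻¹`. [ours] -/
theorem stepHolonomy_gaugeTransform (γ : Site d L → G) (U : GaugeConfig d L G) (x : Site d L)
    (s : Step d) :
    stepHolonomy (gaugeTransform γ U) x s = γ x * stepHolonomy U x s * (γ (s.apply x))⁻¹ := by
  cases s with
  | fwd μ => simp [stepHolonomy, gaugeTransform, Step.apply]
  | bwd μ =>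
    have h : (x - Pi.single μ 1 : Site d L).shift μ = x := by simp [Site.shift]
    simp [stepHolonomy, gaugeTransform, Step.apply, h, mul_assoc]

/-- **Gauge covariance of word holonomies**: `hol_w(U^γ)(x) = γ(x) · hol_w(U)(x) · γ(end)⁻¹` for
every word `w` read from `x` (telescoping). [ours] -/
theorem wordHolonomy_gaugeTransform (γ : Site d L → G) (U : GaugeConfig d L G) :
    ∀ (x : Site d L) (w : Word d), wordHolonomy (gaugeTransform γ U) x w =
      γ x * wordHolonomy U x w * (γ (Word.endpoint x w))⁻¹
  | x, [] => by simp
  | x, s :: w => by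
    rw [wordHolonomy_cons, wordHolonomy_cons, Word.endpoint_cons, stepHolonomy_gaugeTransform,
      wordHolonomy_gaugeTransform γ U (s.apply x) w]
    group

/-- **Closed words: the holonomy transforms by conjugation at the base point.** [ours] -/
theorem wordHolonomy_gaugeTransform_of_closed (γ : Site d L → G) (U : GaugeConfig d L G)
    {x : Site d L} {w : Word d} (hw : Word.endpoint x w = x) :
    wordHolonomy (gaugeTransform γ U) x w = γ x * wordHolonomy U x w * (γ x)⁻¹ := by
  rw [wordHolonomy_gaugeTransform, hw]

/-- **Class functions of closed-word holonomies are gauge-invariant observables** (Wilson loops in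
any class function, e.g. characters). [ours] -/
theorem isGaugeInvariant_classFun_wordHolonomy {α : Type*} {f : G → α}
    (hf : ∀ a b : G, f (b * a * b⁻¹) = f a) {x : Site d L} {w : Word d}
    (hw : Word.endpoint x w = x) :
    IsGaugeInvariant (fun U : GaugeConfig d L G => f (wordHolonomy U x w)) := by
  intro γ U
  simp only [wordHolonomy_gaugeTransform_of_closed γ U hw, hf]

/-- **Necessity**: if `U'` agrees with `U^γ` on every link traversed by a closed word `w` from `x`,
then `hol_w(U') = γ(x) · hol_w(U) · γ(x)⁻¹` — gauge-related configurations have conjugate cycle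
holonomies. [ours] -/
theorem wordHolonomy_eq_conj_of_eqOn {γ : Site d L → G} {U U' : GaugeConfig d L G} {x : Site d L}
    {w : Word d} (hw : Word.endpoint x w = x)
    (h : ∀ e ∈ List.zipWith Step.edge (w.scanl Step.apply x) w, gaugeTransform γ U e = U' e) :
    wordHolonomy U' x w = γ x * wordHolonomy U x w * (γ x)⁻¹ := by
  rw [← wordHolonomy_gaugeTransform_of_closed γ U hw]
  exact (wordHolonomy_congr_of_forall_mem x w h).symm

/-! ## §2 Transport along a simple open path -/

/-- **Transport along a simple open path, starting from a given `γ₀`.**  If the visited sites of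
the word `w` read from `x` are pairwise distinct, then for any two configurations `U, U'` there is a
gauge transformation `γ` that AGREES WITH `γ₀` OFF THE PATH AND AT ITS END and maps `U` to `U'` on
every link traversed by `w` (induction along the word: adjust `γ` at the fresh start site, which no
later link touches). [ours] -/
theorem exists_gaugeTransform_eq_on_path_keep (γ₀ : Site d L → G) (U U' : GaugeConfig d L G) :
    ∀ (w : Word d) (x : Site d L), (w.scanl Step.apply x).Nodup →
      ∃ γ : Site d L → G, (∀ y, y ∉ w.scanl Step.apply x → γ y = γ₀ y) ∧
        γ (Word.endpoint x w) = γ₀ (Word.endpoint x w) ∧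
        ∀ e ∈ List.zipWith Step.edge (w.scanl Step.apply x) w, gaugeTransform γ U e = U' e
  | [], x, _ => ⟨γ₀, fun _ _ => rfl, rfl, by simp⟩
  | s :: w, x, hnd => by
    rw [scanl_apply_cons, List.nodup_cons] at hnd
    obtain ⟨hx, hnd'⟩ := hnd
    obtain ⟨γ', hγ'₀, hγ'e, hγ'⟩ := exists_gaugeTransform_eq_on_path_keep γ₀ U U' w (s.apply x) hnd'
    -- the first link joins `x ∉ sites(w)` and `s.apply x ∈ sites(w)`: incident to `x`, not a loop
    have hx1 : x ≠ s.apply x := (ne_of_mem_of_not_mem (start_mem_scanl (s.apply x) w) hx).symm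
    have hinc : (s.edge x).1 = x ∨ (s.edge x).1.shift (s.edge x).2 = x := by
      rcases edge_endpoints x s with ⟨h1, _⟩ | ⟨_, h2⟩
      · exact Or.inl h1
      · exact Or.inr h2
    have hloop : (s.edge x).1 ≠ (s.edge x).1.shift (s.edge x).2 := by
      rcases edge_endpoints x s with ⟨h1, h2⟩ | ⟨h1, h2⟩
      · rw [h2, h1]; exact hx1
      · rw [h2, h1]; exact hx1.symm
    obtain ⟨g, hg⟩ := exists_update_gaugeTransform_apply_eq γ' U hinc hloop (U' (s.edge x))
    refine ⟨update γ' x g, fun y hy => ?_, ?_, fun e he => ?_⟩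
    · rw [scanl_apply_cons, List.mem_cons, not_or] at hy
      rw [update_of_ne hy.1]
      exact hγ'₀ y hy.2
    · rw [Word.endpoint_cons,
        update_of_ne (ne_of_mem_of_not_mem (endpoint_mem_scanl (s.apply x) w) hx)]
      exact hγ'e
    · rw [zipWith_edge_cons] at he
      rcases List.mem_cons.1 he with rfl | he'
      · exact hg
      · obtain ⟨h1, h2⟩ := endpoints_mem_scanl_of_mem_zipWith (s.apply x) w he'
        rw [gaugeTransform_update_apply_of_not_incident γ' x g U (ne_of_mem_of_not_mem h1 hx)
          (ne_of_mem_of_not_mem h2 hx)]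
        exact hγ' e he'

/-- **Transport with the value at the END prescribed**: `γ(end) = k`. [ours] -/
theorem exists_gaugeTransform_eq_on_path (U U' : GaugeConfig d L G) (w : Word d) (x : Site d L)
    (k : G) (hnd : (w.scanl Step.apply x).Nodup) :
    ∃ γ : Site d L → G, γ (Word.endpoint x w) = k ∧
      ∀ e ∈ List.zipWith Step.edge (w.scanl Step.apply x) w, gaugeTransform γ U e = U' e := by
  obtain ⟨γ, -, hγk, hγ⟩ := exists_gaugeTransform_eq_on_path_keep (fun _ => k) U U' w x hnd
  exact ⟨γ, hγk, hγ⟩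

/-! ## §3 The ear lemma; closing a cycle -/

/-- **THE EAR LEMMA.**  Let `γ₀` be given, and let the word `s :: p` read from `y` be an EAR: the
sites visited after `y` are pairwise distinct, and `y` itself is either off them (an open ear from
`y` to `z = end`) or equal to the end (a closed ear = a cycle through `y`).  If the ear holonomies
satisfy the covariance identity `hol(U') = γ₀(y) · hol(U) · γ₀(z)⁻¹` that `γ₀` WOULD impose, then
some `γ` agreeing with `γ₀` off the interior of the ear, at `z` and at `y`, maps `U` to `U'` on every
link of the ear.  Proof: transport along `p` from `s.apply y` keeping `γ₀`; covariance along `p`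
forces `γ(s.apply y)`, and the hypothesis is then exactly the statement that the first link matches.
This is the inductive step of the gauge classification along an ear decomposition. [ours] -/
theorem exists_gaugeTransform_ear (γ₀ : Site d L → G) (U U' : GaugeConfig d L G) (y : Site d L)
    (s : Step d) (p : Word d) (hnd : (p.scanl Step.apply (s.apply y)).Nodup)
    (hy : y ∉ p.scanl Step.apply (s.apply y) ∨ y = Word.endpoint (s.apply y) p)
    (hhol : wordHolonomy U' y (s :: p) =
      γ₀ y * wordHolonomy U y (s :: p) * (γ₀ (Word.endpoint y (s :: p)))⁻¹) :
    ∃ γ : Site d L → G, (∀ z, z ∉ p.scanl Step.apply (s.apply y) → γ z = γ₀ z) ∧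
      γ (Word.endpoint y (s :: p)) = γ₀ (Word.endpoint y (s :: p)) ∧ γ y = γ₀ y ∧
      ∀ e ∈ List.zipWith Step.edge ((s :: p).scanl Step.apply y) (s :: p),
        gaugeTransform γ U e = U' e := by
  obtain ⟨γ, hoff, hend, hγ⟩ := exists_gaugeTransform_eq_on_path_keep γ₀ U U' p (s.apply y) hnd
  have hyy : γ y = γ₀ y := by
    rcases hy with hy | hy
    · exact hoff y hy
    · rw [hy]; exact hend
  refine ⟨γ, hoff, by rw [Word.endpoint_cons]; exact hend, hyy, fun e he => ?_⟩
  rw [zipWith_edge_cons] at he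
  rcases List.mem_cons.1 he with rfl | he'
  swap
  · exact hγ e he'
  -- the first link: its value is forced by the holonomy condition
  have hcongr : wordHolonomy (gaugeTransform γ U) (s.apply y) p = wordHolonomy U' (s.apply y) p :=
    wordHolonomy_congr_of_forall_mem (s.apply y) p hγ
  have hpU' : wordHolonomy U' (s.apply y) p = γ (s.apply y) * wordHolonomy U (s.apply y) p *
      (γ₀ (Word.endpoint (s.apply y) p))⁻¹ := by
    rw [← hcongr, wordHolonomy_gaugeTransform, hend]
  rw [wordHolonomy_cons, wordHolonomy_cons, Word.endpoint_cons, hpU'] at hhol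
  have hstep : stepHolonomy (gaugeTransform γ U) y s = stepHolonomy U' y s := by
    rw [stepHolonomy_gaugeTransform, hyy]
    symm
    calc stepHolonomy U' y s
        = stepHolonomy U' y s * (γ (s.apply y) * wordHolonomy U (s.apply y) p *
            (γ₀ (Word.endpoint (s.apply y) p))⁻¹) * (γ (s.apply y) *
            wordHolonomy U (s.apply y) p * (γ₀ (Word.endpoint (s.apply y) p))⁻¹)⁻¹ := by group
      _ = γ₀ y * (stepHolonomy U y s * wordHolonomy U (s.apply y) p) *
            (γ₀ (Word.endpoint (s.apply y) p))⁻¹ * (γ (s.apply y) *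
            wordHolonomy U (s.apply y) p * (γ₀ (Word.endpoint (s.apply y) p))⁻¹)⁻¹ := by
          rw [hhol]
      _ = γ₀ y * stepHolonomy U y s * (γ (s.apply y))⁻¹ := by group
  rw [stepHolonomy_eq, stepHolonomy_eq] at hstep
  split_ifs at hstep
  · exact hstep
  · exact inv_injective hstep

/-- **Conjugate cycle holonomies ⇒ gauge related on the cycle, with the conjugator as the value at
the base point.**  Let the word `s :: p` read from `x` be CLOSED and simple (the sites visited after
`x` — ending with `x` itself — pairwise distinct).  If `hol(U') = k · hol(U) · k⁻¹` then some gauge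
transformation `γ` with `γ(x) = k`, constant `= k` off the cycle, maps `U` to `U'` on every link of
the cycle (the closed-ear case of `exists_gaugeTransform_ear` with `γ₀ ≡ k`). [ours] -/
theorem exists_gaugeTransform_eq_on_cycle (U U' : GaugeConfig d L G) (x : Site d L) (s : Step d)
    (p : Word d) (hclosed : Word.endpoint x (s :: p) = x)
    (hnd : (p.scanl Step.apply (s.apply x)).Nodup) (k : G)
    (hhol : wordHolonomy U' x (s :: p) = k * wordHolonomy U x (s :: p) * k⁻¹) :
    ∃ γ : Site d L → G, γ x = k ∧ (∀ z, z ∉ p.scanl Step.apply (s.apply x) → γ z = k) ∧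
      ∀ e ∈ List.zipWith Step.edge ((s :: p).scanl Step.apply x) (s :: p),
        gaugeTransform γ U e = U' e := by
  have hx : x ∉ p.scanl Step.apply (s.apply x) ∨ x = Word.endpoint (s.apply x) p :=
    Or.inr (by rw [Word.endpoint_cons] at hclosed; exact hclosed.symm)
  obtain ⟨γ, hoff, -, hγx, hγ⟩ := exists_gaugeTransform_ear (fun _ => k) U U' x s p hnd hx hhol
  exact ⟨γ, hγx, hoff, hγ⟩

/-! ## §4 The classification: gauge classes on a cycle are conjugacy classes of the holonomy -/

/-- **GAUGE CLASSES ON A CYCLE = CONJUGACY CLASSES OF THE HOLONOMY.**  For a closed simple word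
`s :: p` from `x`, two configurations are gauge related on the links of the cycle iff their cycle
holonomies are conjugate. [ours] -/
theorem gaugeRelated_on_cycle_iff (U U' : GaugeConfig d L G) (x : Site d L) (s : Step d)
    (p : Word d) (hclosed : Word.endpoint x (s :: p) = x)
    (hnd : (p.scanl Step.apply (s.apply x)).Nodup) :
    (∃ γ : Site d L → G, ∀ e ∈ List.zipWith Step.edge ((s :: p).scanl Step.apply x) (s :: p),
        gaugeTransform γ U e = U' e) ↔
      IsConj (wordHolonomy U x (s :: p)) (wordHolonomy U' x (s :: p)) := by
  rw [isConj_iff]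
  constructor
  · rintro ⟨γ, hγ⟩
    exact ⟨γ x, (wordHolonomy_eq_conj_of_eqOn hclosed hγ).symm⟩
  · rintro ⟨k, hk⟩
    obtain ⟨γ, -, -, hγ⟩ := exists_gaugeTransform_eq_on_cycle U U' x s p hclosed hnd k hk.symm
    exact ⟨γ, hγ⟩

/-! ## §5 Instance: the plaquette -/

/-- The links traversed by the plaquette word `+e_i +e_j −e_i −e_j` from `x` are the four
plaquette links `(x, i), (x+e_i, j), (x+e_j, i), (x, j)` (in the order of the tree's
`plaquetteHolonomy`). [ours] -/
theorem plaquette_zipWith_edge (x : Site d L) (i j : Fin d) :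
    List.zipWith Step.edge ((Word.plaquette i j).scanl Step.apply x) (Word.plaquette i j) =
      [(x, i), (x.shift i, j), (x.shift j, i), (x, j)] := by
  have h1 : (x.shift i).shift j - Pi.single i 1 = x.shift j := by simp only [Site.shift]; abel
  have h2 : x.shift j - Pi.single j 1 = x := by simp [Site.shift]
  simp [Word.plaquette, List.scanl_cons, h1, h2]

/-- The sites visited by the plaquette word after its base point — `x+e_i, x+e_i+e_j, x+e_j, x` —
are pairwise distinct (`i ≠ j`, `L ≥ 2`): the plaquette is a simple cycle. [ours] -/
theorem plaquette_tail_scanl_nodup (hL : 2 ≤ L) (x : Site d L) {i j : Fin d} (hij : i ≠ j) :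
    (([Step.fwd j, Step.bwd i, Step.bwd j] : Word d).scanl Step.apply (x.shift i)).Nodup := by
  haveI : Fact (1 < L) := ⟨hL⟩
  have hji : j ≠ i := fun h => hij h.symm
  have h1 : (x.shift i).shift j - Pi.single i 1 = x.shift j := by simp only [Site.shift]; abel
  have h2 : x.shift j - Pi.single j 1 = x := by simp [Site.shift]
  have n1 : x.shift i ≠ (x.shift i).shift j := fun h => by
    have h' := congrFun h j; simp [Site.shift] at h'
  have n2 : x.shift i ≠ x.shift j := fun h => by
    have h' := congrFun h i; simp [Site.shift, hji] at h'
  have n3 : x.shift i ≠ x := fun h => by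
    have h' := congrFun h i; simp [Site.shift] at h'
  have n4 : (x.shift i).shift j ≠ x.shift j := fun h => by
    have h' := congrFun h i; simp [Site.shift, hji] at h'
  have n5 : (x.shift i).shift j ≠ x := fun h => by
    have h' := congrFun h i; simp [Site.shift, hji] at h'
  have n6 : x.shift j ≠ x := fun h => by
    have h' := congrFun h j; simp [Site.shift] at h'
  simp [List.scanl_cons, h1, h2, n1, n2, n3, n4, n5, n6]

/-- **GAUGE CLASSES ON A PLAQUETTE = CONJUGACY CLASSES OF THE PLAQUETTE HOLONOMY** (`i ≠ j`,
`L ≥ 2`): two configurations are gauge related on the four links of the plaquette `(x; i, j)` iff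
their plaquette holonomies `U₁ U₂ U₃⁻¹ U₄⁻¹` are conjugate. [ours] -/
theorem gaugeRelated_on_plaquette_iff (hL : 2 ≤ L) (U U' : GaugeConfig d L G) (x : Site d L)
    {i j : Fin d} (hij : i ≠ j) :
    (∃ γ : Site d L → G, ∀ e ∈ [(x, i), (x.shift i, j), (x.shift j, i), (x, j)],
        gaugeTransform γ U e = U' e) ↔
      IsConj (plaquetteHolonomy U x i j) (plaquetteHolonomy U' x i j) := by
  rw [← plaquette_zipWith_edge x i j, ← wordHolonomy_plaquette U, ← wordHolonomy_plaquette U']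
  exact gaugeRelated_on_cycle_iff U U' x (Step.fwd i) [Step.fwd j, Step.bwd i, Step.bwd j]
    (endpoint_plaquette x i j) (plaquette_tail_scanl_nodup hL x hij)

/-- The plaquette case with the conjugator prescribed at the corner: if
`hol_p(U') = k · hol_p(U) · k⁻¹` then some `γ` with `γ(x) = k` maps `U` to `U'` on the four links.
[ours] -/
theorem exists_gaugeTransform_eq_on_plaquette (hL : 2 ≤ L) (U U' : GaugeConfig d L G)
    (x : Site d L) {i j : Fin d} (hij : i ≠ j) (k : G)
    (hconj : plaquetteHolonomy U' x i j = k * plaquetteHolonomy U x i j * k⁻¹) :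
    ∃ γ : Site d L → G, γ x = k ∧ ∀ e ∈ [(x, i), (x.shift i, j), (x.shift j, i), (x, j)],
      gaugeTransform γ U e = U' e := by
  rw [← wordHolonomy_plaquette U, ← wordHolonomy_plaquette U'] at hconj
  obtain ⟨γ, hγx, -, hγ⟩ := exists_gaugeTransform_eq_on_cycle U U' x (Step.fwd i)
    [Step.fwd j, Step.bwd i, Step.bwd j] (endpoint_plaquette x i j)
    (plaquette_tail_scanl_nodup hL x hij) k hconj
  refine ⟨γ, hγx, ?_⟩
  rw [← plaquette_zipWith_edge x i j]
  exact hγ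

end Summit.Ventures.LatticeQCDFlow.Theory2.Autoregressive

end
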